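import Mathlib
import Literature.Analysis.FluidPDE.LoopCirculation
import HarnessLib

/-!
# Route `TautLoopKelvin`, crux `TautLoopLaw` (stmt-NavierStokesRegularity-15249),
  line `Sketch-ideas-r1k1` (Dini–Saks architecture) — stub `stub_tautLoopRightLscTransfer`

Write `ℓ(v, g) := inf {len γ : γ a closed C¹ loop, g ≤ |∮_γ v · dℓ|} ∈ [0, ∞]` (`inf ∅ = ⊤`) for the
circulation–length spectrum of a field `v : ℝ³ → ℝ³` at level `g`, with
`len γ = ∫₀¹ ‖γ′‖` and `∮_γ v · dℓ = Literature.Analysis.FluidPDE.circulation v γ`.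

**Statement (pure transfer, no PDE).** Let `u : ℝ → (ℝ³ → ℝ³)` be any family of fields, `t ∈ ℝ`,
`g > 0`, with `u t` continuous, `u s` continuous for `s ↓ t`, `sup_x ‖u s x - u t x‖ → 0` as `s ↓ t`
(in the `∀ κ > 0, eventually ≤ κ` form), and assume the level left-continuity
`ℓ(u t, g) ≤ sup_{0 < g' < g} ℓ(u t, g')` whenever the level-`g` class at time `t` is nonempty. Then
`s ↦ ℓ(u s, g)` is right-lower-semicontinuous at `t`: `ℓ(u t, g) ≤ liminf_{s ↓ t} ℓ(u s, g)`.

**Proof.** Let `L` be the `liminf`; WLOG `L < ⊤`. *Key claim:* for `L < L' < ⊤` and `0 < g' < g`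
there is a `C¹` loop `γ` with `g' ≤ |∮_γ u(t)|` and `len γ < L'`. Indeed, with
`κ := (g - g') / (L'.toReal + 1)`, frequently (as `s ↓ t`) `ℓ(u s, g) < L'` while eventually `u s` is
continuous and `‖u s - u t‖_∞ ≤ κ`; at such an `s` pick an admissible `γ` with `len γ < L'`; then
`|∮_γ u(t)| ≥ |∮_γ u(s)| - κ len γ ≥ g - κ L'.toReal ≥ g'` (`|∮_γ w| ≤ ‖w‖_∞ len γ`). Hence
`sup_{g' < g} ℓ(u t, g') ≤ L`, and the level left-continuity closes the nonempty case. If the level-`g`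
class at `t` is empty, the key claim at `g/2` gives a loop with nonzero circulation at time `t`, whose
`k`-fold cover is admissible at level `g` — contradiction (so in that case `L = ⊤`).

The `k`-fold cover lemmas are adapted from `Cruxes/TautLoopLaw/Lines/birth.lean`.
-/

noncomputable section

open Set MeasureTheory Filter Topology Function Literature.Analysis.FluidPDE
open scoped ENNReal NNReal InnerProductSpace RealInnerProductSpace

namespace Summit.NavierStokesRegularity.NavierStokesRegularity.Theorems

set_option linter.dupNamespace false

/-! ## `k`-fold covers of loops multiply circulation by `k` -/

-- adapted from Cruxes/TautLoopLaw/Lines/birth.lean (`isC1Loop_comp_natMul`)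
/-- The `k`-fold cover `s ↦ γ (k s)` of a closed `C¹` loop is a closed `C¹` loop. [folklore] -/
theorem tautLoopRlsc_isC1Loop_comp_natMul {γ : ℝ → EuclideanSpace ℝ (Fin 3)} (hγ : IsC1Loop γ)
    (k : ℕ) : IsC1Loop (fun s => γ ((k : ℝ) * s)) := by
  refine ⟨hγ.contDiff.comp (contDiff_const.mul contDiff_id), fun s => ?_⟩
  show γ ((k : ℝ) * (s + 1)) = γ ((k : ℝ) * s)
  have h := hγ.periodic.nat_mul k ((k : ℝ) * s)
  rw [mul_one] at h
  rw [mul_add, mul_one]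
  exact h

-- adapted from Cruxes/TautLoopLaw/Lines/birth.lean (`circulation_comp_natMul`)
/-- The circulation around the `k`-fold cover is `k` times the circulation (continuous field).
[folklore] -/
theorem tautLoopRlsc_circulation_comp_natMul
    {v : EuclideanSpace ℝ (Fin 3) → EuclideanSpace ℝ (Fin 3)} (hv : Continuous v)
    {γ : ℝ → EuclideanSpace ℝ (Fin 3)} (hγ : IsC1Loop γ) (k : ℕ) :
    circulation v (fun s => γ ((k : ℝ) * s)) = (k : ℝ) * circulation v γ := by
  -- the integrand of the circulation of `γ` and its periodicity / integrability
  set f : ℝ → ℝ := fun σ => ⟪v (γ σ), deriv γ σ⟫ with hf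
  have hfper : Periodic f 1 := fun σ => by
    simp only [hf, hγ.periodic σ, hγ.periodic_deriv σ]
  have hfcont : Continuous f := (hv.comp hγ.continuous).inner hγ.continuous_deriv
  have hfint : ∀ a b : ℝ, IntervalIntegrable f volume a b := fun a b =>
    hfcont.intervalIntegrable a b
  -- the cover's integrand is `k • f (k σ)`
  have hderiv : ∀ s : ℝ, deriv (fun s => γ ((k : ℝ) * s)) s = (k : ℝ) • deriv γ ((k : ℝ) * s) := by
    intro s
    exact deriv_comp_mul_left (k : ℝ) γ s
  have hint : circulation v (fun s => γ ((k : ℝ) * s)) =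
      ∫ s in (0:ℝ)..1, (k : ℝ) * f ((k : ℝ) * s) := by
    unfold circulation
    congr 1
    funext s
    rw [hderiv s, inner_smul_right]
  rw [hint, intervalIntegral.integral_const_mul]
  -- substitution `σ = k s` and periodicity: `k • ∫₀¹ f (k s) ds = ∫₀ᵏ f = k • ∫₀¹ f`
  have hsub : (k : ℝ) • ∫ s in (0:ℝ)..1, f ((k : ℝ) * s) = ∫ σ in (0:ℝ)..(k : ℝ), f σ := by
    have h := intervalIntegral.smul_integral_comp_mul_left (a := (0:ℝ)) (b := 1) f (k : ℝ)
    rw [mul_zero, mul_one] at h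
    exact h
  have hper : ∫ σ in (0:ℝ)..(k : ℝ), f σ = (k : ℝ) * ∫ σ in (0:ℝ)..1, f σ := by
    have h := hfper.intervalIntegral_add_zsmul_eq (k : ℤ) 0 hfint
    simp only [zero_add, zsmul_eq_mul, Int.cast_natCast, mul_one] at h
    simpa using h
  have hcirc : circulation v γ = ∫ σ in (0:ℝ)..1, f σ := rfl
  rw [hcirc, ← hper, ← hsub, smul_eq_mul]

-- adapted from Cruxes/TautLoopLaw/Lines/birth.lean (`exists_level_of_circulation_ne_zero`)
/-- A loop with nonzero circulation yields, by a `k`-fold cover, an admissible loop at any level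
`g`: the level-`g` admissible class is empty iff ALL loop circulations vanish. [folklore] -/
theorem tautLoopRlsc_exists_level_of_circulation_ne_zero
    {v : EuclideanSpace ℝ (Fin 3) → EuclideanSpace ℝ (Fin 3)} (hv : Continuous v)
    {γ : ℝ → EuclideanSpace ℝ (Fin 3)} (hγ : IsC1Loop γ) (hc : circulation v γ ≠ 0) (g : ℝ) :
    ∃ γ' : ℝ → EuclideanSpace ℝ (Fin 3), IsC1Loop γ' ∧ g ≤ |circulation v γ'| := by
  have hcpos : 0 < |circulation v γ| := abs_pos.mpr hc
  obtain ⟨k, hk⟩ := exists_nat_ge (g / |circulation v γ|)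
  refine ⟨fun s => γ ((k : ℝ) * s), tautLoopRlsc_isC1Loop_comp_natMul hγ k, ?_⟩
  rw [tautLoopRlsc_circulation_comp_natMul hv hγ k, abs_mul, Nat.abs_cast]
  rw [div_le_iff₀ hcpos] at hk
  exact hk

/-! ## Sup-norm control of the circulation -/

/-- `|∮_γ w · dℓ| ≤ ‖w‖_∞ · len γ` for a continuous field bounded by `κ` around a `C¹` loop.
[folklore] -/
theorem tautLoopRlsc_abs_circulation_le
    {w : EuclideanSpace ℝ (Fin 3) → EuclideanSpace ℝ (Fin 3)} (hw : Continuous w) {κ : ℝ}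
    (hκ : ∀ x, ‖w x‖ ≤ κ) {γ : ℝ → EuclideanSpace ℝ (Fin 3)} (hγ : IsC1Loop γ) :
    |circulation w γ| ≤ κ * ∫ σ in (0:ℝ)..1, ‖deriv γ σ‖ := by
  unfold circulation
  rw [← intervalIntegral.integral_const_mul]
  refine (intervalIntegral.abs_integral_le_integral_abs zero_le_one).trans ?_
  refine intervalIntegral.integral_mono_on zero_le_one ?_ ?_ (fun σ _ => ?_)
  · exact ((hw.comp hγ.continuous).inner hγ.continuous_deriv).abs.intervalIntegrable 0 1
  · exact (continuous_const.mul hγ.continuous_deriv.norm).intervalIntegrable 0 1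
  · exact (abs_real_inner_le_norm _ _).trans (mul_le_mul_of_nonneg_right (hκ _) (norm_nonneg _))

/-- **Transfer of one loop between two sup-norm close fields.** If `v, w` are continuous with
`‖v x - w x‖ ≤ κ` for all `x` and `γ` is a `C¹` loop, then
`|∮_γ v · dℓ| - κ · len γ ≤ |∮_γ w · dℓ|`. [folklore] -/
theorem tautLoopRlsc_abs_circulation_transfer
    {v w : EuclideanSpace ℝ (Fin 3) → EuclideanSpace ℝ (Fin 3)} (hv : Continuous v)
    (hw : Continuous w) {κ : ℝ} (hκ : ∀ x, ‖v x - w x‖ ≤ κ) {γ : ℝ → EuclideanSpace ℝ (Fin 3)}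
    (hγ : IsC1Loop γ) :
    |circulation v γ| - κ * (∫ σ in (0:ℝ)..1, ‖deriv γ σ‖) ≤ |circulation w γ| := by
  have hsub : circulation (v - w) γ = circulation v γ - circulation w γ :=
    circulation_sub_left hv hw hγ.contDiff
  have hdiff : |circulation (v - w) γ| ≤ κ * ∫ σ in (0:ℝ)..1, ‖deriv γ σ‖ :=
    tautLoopRlsc_abs_circulation_le (hv.sub hw) (fun x => by simpa using hκ x) hγ
  have htri : |circulation v γ| - |circulation w γ| ≤ |circulation (v - w) γ| := by
    rw [hsub]
    exact abs_sub_abs_le_abs_sub _ _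
  linarith

/-! ## The stub -/

local notation3 "ℓ⟦" v ", " g "⟧" => (⨅ (γ' : ℝ → EuclideanSpace ℝ (Fin 3))
  (_ : Literature.Analysis.FluidPDE.IsC1Loop γ' ∧
    g ≤ |Literature.Analysis.FluidPDE.circulation v γ'|),
  ENNReal.ofReal (∫ σ in (0:ℝ)..1, ‖deriv γ' σ‖))

/-- **Right-lower-semicontinuity transfer for the circulation–length spectrum.** For any family
of fields `u : ℝ → (ℝ³ → ℝ³)`, a time `t` and a level `g > 0`: if `u t` is continuous, `u s` is
continuous for `s ↓ t`, `‖u s - u t‖_∞ → 0` as `s ↓ t`, and the spectrum of `u t` is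
left-continuous in the level at `g` whenever the level-`g` class is nonempty, then
`ℓ(u t, g) ≤ liminf_{s ↓ t} ℓ(u s, g)` (a near-optimal loop at time `s` is admissible at time `t` at
level `g - κ·length`; `k`-fold covers show that an empty class at `t` forces `liminf = ⊤`). [folklore] -/
theorem stub_tautLoopRightLscTransfer : ∀ (u : ℝ → EuclideanSpace ℝ (Fin 3) → EuclideanSpace ℝ (Fin 3)) (t g : ℝ), 0 < g → Continuous (u t) → (∀ᶠ s in nhdsWithin t (Set.Ioi t), Continuous (u s)) → (∀ κ : ℝ, 0 < κ → ∀ᶠ s in nhdsWithin t (Set.Ioi t), ∀ x, ‖u s x - u t x‖ ≤ κ) → ((∃ γ : ℝ → EuclideanSpace ℝ (Fin 3), Literature.Analysis.FluidPDE.IsC1Loop γ ∧ g ≤ |Literature.Analysis.FluidPDE.circulation (u t) γ|) → (⨅ (γ' : ℝ → EuclideanSpace ℝ (Fin 3)) (_ : Literature.Analysis.FluidPDE.IsC1Loop γ' ∧ g ≤ |Literature.Analysis.FluidPDE.circulation (u t) γ'|), ENNReal.ofReal (∫ σ in (0:ℝ)..1, ‖deriv γ' σ‖)) ≤ ⨆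 (g' : ℝ) (_ : 0 < g' ∧ g' < g), (⨅ (γ' : ℝ → EuclideanSpace ℝ (Fin 3)) (_ : Literature.Analysis.FluidPDE.IsC1Loop γ' ∧ g' ≤ |Literature.Analysis.FluidPDE.circulation (u t) γ'|), ENNReal.ofReal (∫ σ in (0:ℝ)..1, ‖deriv γ' σ‖))) → (⨅ (γ' : ℝ → EuclideanSpace ℝ (Fin 3)) (_ : Literature.Analysis.FluidPDE.IsC1Loop γ' ∧ g ≤ |Literature.Analysis.FluidPDE.circulation (u t) γ'|), ENNReal.ofReal (∫ σ in (0:ℝ)..1, ‖deriv γ' σ‖)) ≤ Filter.liminf (fun s => (⨅ (γ' : ℝ → EuclideanSpace ℝ (Fin 3)) (_ : Literature.Analysis.FluidPDE.IsC1Loop γ' ∧ g ≤ |Literature.Analysis.FluidPDE.circulation (u s) γ'|), ENNReal.ofReal (∫ σ in (0:ℝ)..1, ‖deriv γ' σ‖))) (nhdsWithin t (Set.Ioi t)) := by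
  intro u t g hg hcont hevC hevK hLLC
  -- lengths are nonnegative
  have hlen0 : ∀ γ : ℝ → EuclideanSpace ℝ (Fin 3), 0 ≤ ∫ σ in (0:ℝ)..1, ‖deriv γ σ‖ := fun γ =>
    intervalIntegral.integral_nonneg zero_le_one fun σ _ => norm_nonneg _
  set L := Filter.liminf (fun s => ℓ⟦u s, g⟧) (𝓝[>] t) with hL_def
  by_cases hLtop : L = ⊤
  · rw [hLtop]
    exact le_top
  have hLlt : L < ⊤ := lt_top_iff_ne_top.2 hLtop
  -- KEY CLAIM: above `L`, every lower level `g' < g` is realised at time `t` by a short loop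
  have key : ∀ L' : ℝ≥0∞, L < L' → L' < ⊤ → ∀ g' : ℝ, 0 < g' → g' < g →
      ∃ γ : ℝ → EuclideanSpace ℝ (Fin 3), IsC1Loop γ ∧ g' ≤ |circulation (u t) γ| ∧
        ENNReal.ofReal (∫ σ in (0:ℝ)..1, ‖deriv γ σ‖) < L' := by
    intro L' hLL' hL'top g' _hg'pos hg'lt
    have hR0 : 0 ≤ L'.toReal := ENNReal.toReal_nonneg
    set κ : ℝ := (g - g') / (L'.toReal + 1) with hκ_def
    have hκpos : 0 < κ := div_pos (sub_pos.2 hg'lt) (by positivity)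
    have hκle : κ * L'.toReal ≤ g - g' := by
      rw [hκ_def, div_mul_eq_mul_div, div_le_iff₀ (by positivity)]
      nlinarith [sub_pos.2 hg'lt]
    have hfreq : ∃ᶠ s in 𝓝[>] t, ℓ⟦u s, g⟧ < L' := frequently_lt_of_liminf_lt (h := hLL')
    obtain ⟨s, hs_lt, hs_cont, hs_K⟩ := (hfreq.and_eventually (hevC.and (hevK κ hκpos))).exists
    obtain ⟨γ, hγ⟩ := iInf_lt_iff.1 hs_lt
    obtain ⟨⟨hγloop, hγg⟩, hγlen⟩ := iInf_lt_iff.1 hγ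
    have hlen_lt : (∫ σ in (0:ℝ)..1, ‖deriv γ σ‖) < L'.toReal :=
      (ENNReal.ofReal_lt_iff_lt_toReal (hlen0 γ) hL'top.ne).1 hγlen
    have htrans := tautLoopRlsc_abs_circulation_transfer hs_cont hcont hs_K hγloop
    refine ⟨γ, hγloop, ?_, hγlen⟩
    have h1 : κ * (∫ σ in (0:ℝ)..1, ‖deriv γ σ‖) ≤ κ * L'.toReal :=
      mul_le_mul_of_nonneg_left hlen_lt.le hκpos.le
    linarith
  -- CONSEQUENCE: the left level-limit at time `t` is below `L`
  have hsup : (⨆ (g' : ℝ) (_ : 0 < g' ∧ g' < g), ℓ⟦u t, g'⟧) ≤ L := by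
    refine iSup₂_le fun g' hg' => ?_
    refine ENNReal.le_of_forall_pos_le_add fun ε hε _ => ?_
    have h1 : L < L + ε := ENNReal.lt_add_right hLtop (ENNReal.coe_ne_zero.2 hε.ne')
    have h2 : L + (ε : ℝ≥0∞) < ⊤ := ENNReal.add_lt_top.2 ⟨hLlt, ENNReal.coe_lt_top⟩
    obtain ⟨γ, hγ, hγg, hγlen⟩ := key _ h1 h2 g' hg'.1 hg'.2
    exact (iInf₂_le γ ⟨hγ, hγg⟩).trans hγlen.le
  by_cases hne : ∃ γ : ℝ → EuclideanSpace ℝ (Fin 3), IsC1Loop γ ∧ g ≤ |circulation (u t) γ|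
  · exact (hLLC hne).trans hsup
  · -- empty class at `t` is impossible when `L < ⊤`: `k`-fold covers
    exfalso
    have h1 : L < L + 1 := ENNReal.lt_add_right hLtop one_ne_zero
    have h2 : L + 1 < ⊤ := ENNReal.add_lt_top.2 ⟨hLlt, ENNReal.one_lt_top⟩
    obtain ⟨γ, hγ, hγg, -⟩ := key _ h1 h2 (g / 2) (half_pos hg) (half_lt_self hg)
    have hc : circulation (u t) γ ≠ 0 := by
      intro h
      rw [h, abs_zero] at hγg
      linarith
    exact hne (tautLoopRlsc_exists_level_of_circulation_ne_zero hcont hγ hc g)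

end Summit.NavierStokesRegularity.NavierStokesRegularity.Theorems

end
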